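import Summits.ABC.StewartYu.PadicG3TwoScheduleNumerics
import Summits.ABC.StewartYu.PadicG3TwoFrameNumericsR
import HarnessLib

/-!
# Cell abc-stewartyu, Gen-3 frame at `p = 2` (crux `Y07Two`, stmt-ABC-19659), record interface v2: the `p = 2`
# schedule WITH SHRINKING BOXES `schedTwoR` and its frame numerics `FrameNumericsTwoR` reduced to the budget lines

`Summits/ABC/StewartYu/PadicG3TwoScheduleR.lean` — cell `abc-stewartyu` (HOME `run/shared/lean/pub/abc-stewartyu/`),
route `PadicPrimesKummerThird`, seat p5 (g3); v2 of `PadicG3TwoSchedule(Numerics)` for the base-relative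
re-indexing (p1-g7 record flag 2026-08-27T02:31Z).  Definitions (`Dbox3R`, `Dθ3R`, `Xb3R`, `schedTwoR`) and
theorems; no named fact.

`schedTwoR S P` = `schedTwo S P` except the exponent boxes: level `0` keeps the half-sides `Dbox3 P 0 j =
⌊L/(2Aⱼ)⌋ + 1`, `Dθ3 P 0`, and level `I ≥ 1` has `2·Dbox3 P 0 j/3^I`, `2·Dθ3 P 0/3^I` (Nesterenko (4.35): the
level-`I` exponents are differences of two points of the original box divided by `3^I`) — these VANISH once
`3^I > 2·side`, so the far-height line of the k-step budget decays geometrically with the level.  The directional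
bound `Xb3R` follows the boxes.  **`frameNumericsTwoR_schedTwoR`**: `FrameNumericsTwoR (schedTwoR S P) P.H P.L₀` from
the depth fit `8·3^{I*} ≤ 4L`, (L1) the binomial Siegel count, (L2) the k-step lines, (L3) the third-step lines (v2
shape), all stated on the projections of `schedTwoR` (rewrite with `schedTwoR_*`).

WHAT THIS IS NOT: the budget lines (record: p1 / lp-1); no crux moves.

References: Yu. V. Nesterenko, LNM 1819 (2003), §4 (4.3)–(4.5), (4.35); K. Yu, Acta Math. 211 (2013), §3.1, (5.1)(i).
-/

noncomputable section

open Finset Polynomial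
open Literature.NumberTheory.Transcendental
open Literature.NumberTheory.Transcendental (FeldmanDelta.den)
open Literature.NumberTheory.Transcendental.FeldmanDelta
open Literature.NumberTheory.Transcendental.CW77 (heightProd)
open Literature.NumberTheory.Transcendental.CW77.Setup (Tau tauNorm)
open Literature.NumberTheory.Transcendental.PadicCW77 (condExp)

namespace Summit.ABC.StewartYu

namespace TwoSetup

open Summit.ABC.StewartYu.FeldmanBasis Summit.ABC.StewartYu.G3Boxes

variable (S : TwoSetup) (P : PadicG3Par (S.d + 1))

/-! ### The shrinking boxes -/

/-- **Exponent box at level `I` (v2)**: the level-`0` half-side at `I = 0`, `2·side/3^I` at `I ≥ 1`.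
[cite: Nesterenko2003, §4.3 (4.35); shape only] -/
def Dbox3R (I : ℕ) (j : Fin S.d) : ℕ := if I = 0 then S.Dbox3 P 0 j else 2 * S.Dbox3 P 0 j / 3 ^ I

/-- **Exponent box at level `I` in `θ` (v2).** [cite: Nesterenko2003, §4.3 (4.35); shape only] -/
def Dθ3R (I : ℕ) : ℕ := if I = 0 then S.Dθ3 P 0 else 2 * S.Dθ3 P 0 / 3 ^ I

/-- **Directional bound at level `I` (v2)**: `1 + |b_θ|·∑ⱼ Dbox3R I j + (∑ⱼ |bⱼ|)·Dθ3R I`. [folklore] -/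
def Xb3R (I : ℕ) : ℤ := 1 + |S.bθ| * ∑ j, (S.Dbox3R P I j : ℤ) + (∑ j, |S.b j|) * (S.Dθ3R P I : ℤ)

/-- Level `0` boxes are the half-sides. [folklore] -/
@[simp] theorem Dbox3R_zero : S.Dbox3R P 0 = S.Dbox3 P 0 := funext fun _ => if_pos rfl

/-- Level `0` box in `θ`. [folklore] -/
@[simp] theorem Dθ3R_zero : S.Dθ3R P 0 = S.Dθ3 P 0 := if_pos rfl

/-- Deep boxes: `Dbox3R (I+1) j = 2·Dbox3 0 j/3^{I+1}`. [folklore] -/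
theorem Dbox3R_succ (I : ℕ) (j : Fin S.d) : S.Dbox3R P (I + 1) j = 2 * S.Dbox3 P 0 j / 3 ^ (I + 1) :=
  if_neg (Nat.succ_ne_zero I)

/-- Deep boxes in `θ`. [folklore] -/
theorem Dθ3R_succ (I : ℕ) : S.Dθ3R P (I + 1) = 2 * S.Dθ3 P 0 / 3 ^ (I + 1) := if_neg (Nat.succ_ne_zero I)

/-- Level `0` directional bound agrees with v1. [folklore] -/
theorem Xb3R_zero : S.Xb3R P 0 = S.Xb3 P 0 := by
  unfold Xb3R Xb3; rw [Dbox3R_zero, Dθ3R_zero]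

/-- The directional bound dominates `|b_θ|·Dbox3R I j + |bⱼ|·Dθ3R I`. [folklore] -/
theorem Xb3R_ge (I : ℕ) (j : Fin S.d) :
    |S.bθ| * (S.Dbox3R P I j : ℤ) + |S.b j| * (S.Dθ3R P I : ℤ) ≤ S.Xb3R P I := by
  unfold Xb3R
  have h1 : (S.Dbox3R P I j : ℤ) ≤ ∑ j', (S.Dbox3R P I j' : ℤ) :=
    Finset.single_le_sum (f := fun j' => (S.Dbox3R P I j' : ℤ)) (fun _ _ => by positivity) (Finset.mem_univ j)
  have h2 : |S.b j| ≤ ∑ j', |S.b j'| :=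
    Finset.single_le_sum (f := fun j' => |S.b j'|) (fun _ _ => abs_nonneg _) (Finset.mem_univ j)
  have h3 : (0 : ℤ) ≤ S.Dθ3R P I := by positivity
  nlinarith [abs_nonneg S.bθ, mul_le_mul_of_nonneg_left h1 (abs_nonneg S.bθ),
    mul_le_mul_of_nonneg_right h2 h3]

/-- `1 ≤ Xb3R I`. [folklore] -/
theorem one_le_Xb3R (I : ℕ) : 1 ≤ S.Xb3R P I := by
  unfold Xb3R
  have h1 : (0 : ℤ) ≤ |S.bθ| * ∑ j, (S.Dbox3R P I j : ℤ) :=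
    mul_nonneg (abs_nonneg _) (Finset.sum_nonneg fun _ _ => by positivity)
  have h2 : (0 : ℤ) ≤ (∑ j, |S.b j|) * (S.Dθ3R P I : ℤ) :=
    mul_nonneg (Finset.sum_nonneg fun _ _ => abs_nonneg _) (by positivity)
  linarith

/-! ### The schedule (v2) -/

/-- **THE `p = 2` SCHEDULE WITH SHRINKING BOXES `σ₂ᴿ`.** [cite: Nesterenko2003, §4 (4.3)–(4.5), (4.35); shape only] -/
def schedTwoR : S.G3TwoSched where
  Istar := S.Istar3 P
  m := P.m
  D₀ := P.L₀
  P := ⌈((famBox P.L₀ (S.Dbox3 P 0) (S.Dθ3 P 0)).card : ℝ) * S.Amax3 P (S.one_le_T03 P 0)⌉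
  cardB := fun _ => (famBox P.L₀ (S.Dbox3 P 0) (S.Dθ3 P 0)).card
  Dbox := S.Dbox3R P
  Dθ := S.Dθ3R P
  Xb := S.Xb3R P
  Bw := fun _ => S.Bw3 P
  den₀ := fun _ _ τ => Nat.lcmUpto P.H ^ τ.1
  M₀ := S.M₀3 P
  N0 := fun I => S.Nsub3 P I 0
  T0 := S.T03 P
  Nfin := fun I => 3 ^ (S.d + 2) * S.Xs3 P I
  Tfin := fun I => S.T03 P I - (S.d + 2) * S.T3 P I
  kst := fun _ => S.d + 2
  tdec := S.T3 P
  Nsub := S.Nsub3 P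

/-- Projection of `schedTwoR`. [folklore] -/
@[simp] theorem schedTwoR_Istar : (S.schedTwoR P).Istar = S.Istar3 P := rfl
/-- Projection of `schedTwoR`. [folklore] -/
@[simp] theorem schedTwoR_m : (S.schedTwoR P).m = P.m := rfl
/-- Projection of `schedTwoR`. [folklore] -/
@[simp] theorem schedTwoR_D₀ : (S.schedTwoR P).D₀ = P.L₀ := rfl
/-- Projection of `schedTwoR`. [folklore] -/
@[simp] theorem schedTwoR_cardB (I : ℕ) :
    (S.schedTwoR P).cardB I = (famBox P.L₀ (S.Dbox3 P 0) (S.Dθ3 P 0)).card := rfl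
/-- Projection of `schedTwoR`. [folklore] -/
@[simp] theorem schedTwoR_Dbox : (S.schedTwoR P).Dbox = S.Dbox3R P := rfl
/-- Projection of `schedTwoR`. [folklore] -/
@[simp] theorem schedTwoR_Dθ : (S.schedTwoR P).Dθ = S.Dθ3R P := rfl
/-- Projection of `schedTwoR`. [folklore] -/
@[simp] theorem schedTwoR_Xb : (S.schedTwoR P).Xb = S.Xb3R P := rfl
/-- Projection of `schedTwoR`. [folklore] -/
@[simp] theorem schedTwoR_Bw (I : ℕ) : (S.schedTwoR P).Bw I = S.Bw3 P := rfl
/-- Projection of `schedTwoR`. [folklore] -/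
@[simp] theorem schedTwoR_den₀ (I : ℕ) (x : ℤ) (τ : Tau S.d) :
    (S.schedTwoR P).den₀ I x τ = Nat.lcmUpto P.H ^ τ.1 := rfl
/-- Projection of `schedTwoR`. [folklore] -/
@[simp] theorem schedTwoR_M₀ : (S.schedTwoR P).M₀ = S.M₀3 P := rfl
/-- Projection of `schedTwoR`. [folklore] -/
@[simp] theorem schedTwoR_N0 (I : ℕ) : (S.schedTwoR P).N0 I = S.Nsub3 P I 0 := rfl
/-- Projection of `schedTwoR`. [folklore] -/
@[simp] theorem schedTwoR_T0 : (S.schedTwoR P).T0 = S.T03 P := rfl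
/-- Projection of `schedTwoR`. [folklore] -/
@[simp] theorem schedTwoR_Nfin (I : ℕ) : (S.schedTwoR P).Nfin I = 3 ^ (S.d + 2) * S.Xs3 P I := rfl
/-- Projection of `schedTwoR`. [folklore] -/
@[simp] theorem schedTwoR_Tfin (I : ℕ) : (S.schedTwoR P).Tfin I = S.T03 P I - (S.d + 2) * S.T3 P I := rfl
/-- Projection of `schedTwoR`. [folklore] -/
@[simp] theorem schedTwoR_kst (I : ℕ) : (S.schedTwoR P).kst I = S.d + 2 := rfl
/-- Projection of `schedTwoR`. [folklore] -/
@[simp] theorem schedTwoR_tdec : (S.schedTwoR P).tdec = S.T3 P := rfl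
/-- Projection of `schedTwoR`. [folklore] -/
@[simp] theorem schedTwoR_Nsub : (S.schedTwoR P).Nsub = S.Nsub3 P := rfl
/-- Projection of `schedTwoR`. [folklore] -/
@[simp] theorem schedTwoR_P : (S.schedTwoR P).P =
    ⌈((famBox P.L₀ (S.Dbox3 P 0) (S.Dθ3 P 0)).card : ℝ) * S.Amax3 P (S.one_le_T03 P 0)⌉ := rfl

/-- `KTwo` of the v2 schedule is positive. [folklore] -/
theorem KTwo_schedTwoR_pos (I : ℕ) (x : ℤ) (τ : Tau S.d) : 0 < KTwo (S.schedTwoR P) I x τ := by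
  unfold KTwo
  rw [schedTwoR_cardB, schedTwoR_P, schedTwoR_M₀, schedTwoR_Xb, schedTwoR_Dbox, schedTwoR_Dθ]
  have hcard : (0 : ℝ) < (((famBox P.L₀ (S.Dbox3 P 0) (S.Dθ3 P 0)).card : ℕ) : ℝ) := by
    rw [card_famBox]; positivity
  have hc1 : (1 : ℝ) ≤ ((famBox P.L₀ (S.Dbox3 P 0) (S.Dθ3 P 0)).card : ℝ) := by
    rw [card_famBox]; exact_mod_cast Nat.one_le_iff_ne_zero.mpr (by positivity)
  have hA1 : (1 : ℝ) ≤ S.Amax3 P (S.one_le_T03 P 0) := le_max_left _ _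
  have hP1 : (1 : ℤ) ≤ ⌈((famBox P.L₀ (S.Dbox3 P 0) (S.Dθ3 P 0)).card : ℝ) * S.Amax3 P (S.one_le_T03 P 0)⌉ :=
    Int.one_le_ceil_iff.mpr (by nlinarith)
  have hP : (0 : ℝ) < ((⌈((famBox P.L₀ (S.Dbox3 P 0) (S.Dθ3 P 0)).card : ℝ) *
      S.Amax3 P (S.one_le_T03 P 0)⌉ : ℤ) : ℝ) := by exact_mod_cast hP1
  have hM : (0 : ℝ) < ((S.M₀3 P I x τ : ℤ) : ℝ) := by
    have h := S.M₀3_ge P I x τ 0 (Nat.zero_le _)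
    rw [pow_zero, mul_one] at h
    have hpos : (0 : ℝ) < (3 : ℝ) ^ ((S.Istar3 P - I) * τ.1) * ((Nat.lcmUpto P.H : ℝ) ^ τ.1 *
        Real.exp (P.H / Real.exp 1)) := by
      have : (0 : ℝ) < (Nat.lcmUpto P.H : ℝ) := by exact_mod_cast Nat.lcmUpto_pos P.H
      positivity
    exact hpos.trans_le h
  have hXb : (0 : ℝ) < ((S.Xb3R P I : ℤ) : ℝ) ^ (∑ j, τ.2 j) := by
    refine pow_pos ?_ _
    have h1 := S.one_le_Xb3R P I
    exact_mod_cast (show (0 : ℤ) < S.Xb3R P I by omega)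
  have hmon : (0 : ℝ) < ((MonomialDen.monDen S.toQ.all (S.boxExp (S.Dbox3R P I) (S.Dθ3R P I) x) : ℝ)) ^ 2 := by
    have : 1 ≤ MonomialDen.monDen S.toQ.all (S.boxExp (S.Dbox3R P I) (S.Dθ3R P I) x) :=
      MonomialDen.one_le_monDen _ S.toQ.all_ne _
    positivity
  positivity

/-! ### The frame numerics (v2) from the budget lines -/

/-- **Inner-chain obligations of `schedTwoR` at level `I`** from the k-step lines. [cite: Nesterenko2003, §4; shape only] -/
theorem kfinalTwo_schedTwoR (I : ℕ) (hT : 8 ≤ S.T3 P I)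
    (hL2 : ∀ k, k < (S.schedTwoR P).kst I → ∀ x₁ : ℤ, |x₁| ≤ ((S.schedTwoR P).Nsub I (k + 1) : ℤ) →
      ∀ τ : Tau S.d, tauNorm τ + (S.schedTwoR P).tdec I ≤ (S.schedTwoR P).T0 I - k * (S.schedTwoR P).tdec I →
      max ((S.schedTwoR P).Bw I * ‖S.Λ₀‖ * (2 : ℝ) ^ (S.schedTwoR P).tdec I *
            (2 : ℝ) ^ condExp 2 (2 * (S.schedTwoR P).Nsub I k + 1) ((S.schedTwoR P).tdec I))
          ((S.schedTwoR P).Bw I / (4 * (2 : ℝ) ^ (S.schedTwoR P).m) ^ gainExp (S.schedTwoR P) I k) <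
        1 / KTwo (S.schedTwoR P) I x₁ τ) :
    KFinalTwo (S.schedTwoR P) I where
  Nsub_zero := rfl
  Nfin_le := by
    rw [schedTwoR_Nfin, schedTwoR_Nsub, schedTwoR_kst]
    unfold Nsub3
    rw [if_neg (by omega)]
  Tfin_le := by
    rw [schedTwoR_Tfin, schedTwoR_kst, schedTwoR_tdec, schedTwoR_T0]
    have := (S.T03_budget P I hT).1
    omega
  one_le_kst := by rw [schedTwoR_kst]; omega
  one_le_tdec := by rw [schedTwoR_tdec]; omega
  Xb_nonneg := le_trans zero_le_one (S.one_le_Xb3R P I)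
  one_le_den₀ := fun _ _ => Nat.one_le_pow _ _ (Nat.lcmUpto_pos P.H)
  KTwo_pos := S.KTwo_schedTwoR_pos P I
  hfinal := hL2

/-- **Third-step obligations (v2) of `schedTwoR` at level `I`** from the third-step line. [cite: Yu2013, Lemma 5.4; shape only] -/
theorem thirdFinalTwoR_schedTwoR (I : ℕ) (hT : 8 ≤ S.T3 P I)
    (hL3 : ∀ s : ℤ, |s| ≤ ((S.schedTwoR P).N0 (I + 1) : ℤ) → ¬ (3 : ℤ) ∣ s → ∀ τ : Tau S.d,
      tauNorm τ < (S.schedTwoR P).T0 (I + 1) →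
      max ((S.schedTwoR P).Bw I * ‖S.Λ₀‖ * (2 : ℝ) ^ ((S.schedTwoR P).Tfin I - (S.schedTwoR P).T0 (I + 1)) *
            (2 : ℝ) ^ condExp 2 (2 * (S.schedTwoR P).Nfin I + 1)
              ((S.schedTwoR P).Tfin I - (S.schedTwoR P).T0 (I + 1)))
          ((S.schedTwoR P).Bw I / (4 * (2 : ℝ) ^ (S.schedTwoR P).m) ^
            ((2 * (S.schedTwoR P).Nfin I + 1) * ((S.schedTwoR P).Tfin I - (S.schedTwoR P).T0 (I + 1)))) <
        1 / (6 * (thirdDen (S.schedTwoR P) I s τ : ℝ) * thirdM (S.schedTwoR P) I s τ *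
          heightProd S.toQ.all ^ 5) ^ (3 ^ (S.d + 1 + 1) - 1)) :
    ThirdFinalTwoR (S.schedTwoR P) I where
  tthird_pos := by
    rw [schedTwoR_Tfin, schedTwoR_T0]
    have h1 := (S.T03_budget P I hT).1
    have h2 := (S.T03_budget P I hT).2
    omega
  T0_succ_le := by
    rw [schedTwoR_Tfin, schedTwoR_T0]
    have h1 := (S.T03_budget P I hT).1
    have h2 := (S.T03_budget P I hT).2
    omega
  cardB_mono := le_rfl
  Bw_mono := le_rfl
  Xb_succ := fun j => by rw [schedTwoR_Dbox, schedTwoR_Dθ, schedTwoR_Xb]; exact S.Xb3R_ge P (I + 1) j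
  one_le_den₀ := fun _ _ => Nat.one_le_pow _ _ (Nat.lcmUpto_pos P.H)
  hfinal := hL3

/-- **THE FRAME NUMERICS (v2) OF `schedTwoR` FROM THE BUDGET LINES** (depth fit, (L1), (L2), (L3) v2 shape); the
box slots, the level-`0` sizes and all bookkeeping hold by construction.
[cite: Nesterenko2003, §4 (4.3)–(4.5), (4.35) and Prop 3.9; shape only] -/
theorem frameNumericsTwoR_schedTwoR
    (hdepth : 8 * 3 ^ S.Istar3 P ≤ 4 * P.L)
    (hL1 : 2 * 2 ^ (S.schedTwoR P).m *
        ((2 * (S.schedTwoR P).N0 0 + 1) * ((S.schedTwoR P).T0 0 + S.d).choose (S.d + 1)) ≤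
      (P.L₀ + 1) * ((∏ j, (2 * (S.schedTwoR P).Dbox 0 j + 1)) * (2 * (S.schedTwoR P).Dθ 0 + 1)))
    (hL2 : ∀ I, I ≤ S.Istar3 P → ∀ k, k < (S.schedTwoR P).kst I → ∀ x₁ : ℤ,
      |x₁| ≤ ((S.schedTwoR P).Nsub I (k + 1) : ℤ) →
      ∀ τ : Tau S.d, tauNorm τ + (S.schedTwoR P).tdec I ≤ (S.schedTwoR P).T0 I - k * (S.schedTwoR P).tdec I →
      max ((S.schedTwoR P).Bw I * ‖S.Λ₀‖ * (2 : ℝ) ^ (S.schedTwoR P).tdec I *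
            (2 : ℝ) ^ condExp 2 (2 * (S.schedTwoR P).Nsub I k + 1) ((S.schedTwoR P).tdec I))
          ((S.schedTwoR P).Bw I / (4 * (2 : ℝ) ^ (S.schedTwoR P).m) ^ gainExp (S.schedTwoR P) I k) <
        1 / KTwo (S.schedTwoR P) I x₁ τ)
    (hL3 : ∀ I, I < S.Istar3 P → ∀ s : ℤ, |s| ≤ ((S.schedTwoR P).N0 (I + 1) : ℤ) → ¬ (3 : ℤ) ∣ s →
      ∀ τ : Tau S.d, tauNorm τ < (S.schedTwoR P).T0 (I + 1) →
      max ((S.schedTwoR P).Bw I * ‖S.Λ₀‖ * (2 : ℝ) ^ ((S.schedTwoR P).Tfin I - (S.schedTwoR P).T0 (I + 1)) *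
            (2 : ℝ) ^ condExp 2 (2 * (S.schedTwoR P).Nfin I + 1)
              ((S.schedTwoR P).Tfin I - (S.schedTwoR P).T0 (I + 1)))
          ((S.schedTwoR P).Bw I / (4 * (2 : ℝ) ^ (S.schedTwoR P).m) ^
            ((2 * (S.schedTwoR P).Nfin I + 1) * ((S.schedTwoR P).Tfin I - (S.schedTwoR P).T0 (I + 1)))) <
        1 / (6 * (thirdDen (S.schedTwoR P) I s τ : ℝ) * thirdM (S.schedTwoR P) I s τ *
          heightProd S.toQ.all ^ 5) ^ (3 ^ (S.d + 1 + 1) - 1)) :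
    FrameNumericsTwoR (S.schedTwoR P) P.H P.L₀ := by
  have hH : 1 ≤ P.H := le_max_left _ _
  have hT8 : ∀ I, I ≤ S.Istar3 P → 8 ≤ S.T3 P I := by
    intro I hI
    unfold T3
    have h3 : 3 ^ I ≤ 3 ^ S.Istar3 P := Nat.pow_le_pow_right (by norm_num) hI
    have hpos : 0 < 3 ^ I := by positivity
    rw [Nat.le_div_iff_mul_le hpos]
    calc 8 * 3 ^ I ≤ 8 * 3 ^ S.Istar3 P := Nat.mul_le_mul_left _ h3
      _ ≤ 4 * P.L := hdepth
  refine
    { one_le_H := hH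
      T0_pos := S.one_le_T03 P 0
      count := hL1
      cardB0 := by rw [schedTwoR_Dbox, schedTwoR_Dθ, Dbox3R_zero, Dθ3R_zero, schedTwoR_cardB]
      L_le := le_rfl
      Xb0 := ?_
      Bw0 := fun ℓ hℓ => S.Bw3_ge P ℓ hℓ
      den₀_eq := fun _ _ _ => rfl
      M₀_ge := fun I _ x τ ℓ hℓ => S.M₀3_ge P I x τ ℓ hℓ
      level0_size := ?_
      box := ?_
      kfinal := fun I hI => S.kfinalTwo_schedTwoR P I (hT8 I hI) (hL2 I hI)
      third := fun I hI => S.thirdFinalTwoR_schedTwoR P I (hT8 I hI.le) (hL3 I hI) }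
  · intro i hi j
    rw [schedTwoR_Xb]
    rw [schedTwoR_Dbox, schedTwoR_Dθ, Dbox3R_zero, Dθ3R_zero] at hi
    have hb := (mem_famBox.mp hi).2
    have h := S.Xb3R_ge P 0 j
    rw [Dbox3R_zero, Dθ3R_zero] at h
    exact (S.abs_dirScalar_le hb.1 hb.2 j).trans h
  · refine ⟨S.M₀E3 P (S.one_le_T03 P 0), S.Amax3 P (S.one_le_T03 P 0), ?_, le_max_left _ _, ?_, ?_⟩
    · intro e he
      rw [schedTwoR_M₀]
      rw [schedTwoR_N0, schedTwoR_T0, Nsub3_zero_zero] at he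
      exact S.M₀3_le_M₀E3 P _ he
    · intro e he
      rw [schedTwoR_Xb, schedTwoR_Dbox, schedTwoR_Dθ, Dbox3R_zero, Dθ3R_zero, Xb3R_zero]
      rw [schedTwoR_N0, schedTwoR_T0, Nsub3_zero_zero] at he
      exact S.prod_le_Amax3 P _ he
    · rw [schedTwoR_P, schedTwoR_Dbox, schedTwoR_Dθ, Dbox3R_zero, Dθ3R_zero]
  · intro I _
    rw [schedTwoR_Dbox, schedTwoR_Dθ, Dbox3R_zero, Dθ3R_zero]
    refine ⟨fun j => ?_, ?_⟩
    · rw [Dbox3R_succ]; push_cast; exact le_rfl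
    · rw [Dθ3R_succ]; push_cast; exact le_rfl

end TwoSetup

end Summit.ABC.StewartYu

end
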